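import Literature.Analysis.FluidPDE.OnsagerBDSV
import Literature.Analysis.FluidPDE.FractionalNSReynolds
import HarnessLib

/-!
# De Rosa's convex-integration scheme for the hypodissipative Navier–Stokes system:
# the vocabulary of the iteration (admissible profiles, De Rosa sequences) and the
# time-regularity step (named fact)

L. De Rosa, *Infinitely many Leray–Hopf solutions for the fractional Navier–Stokes equations*,
Comm. PDE 44 (2019) = arXiv:1801.10235, proves his Thm. 2.1 (prescribed-energy Hölder solutions
of `∂ₜv + div(v ⊗ v) + ∇p + (-Δ)^γ v = 0` on `𝕋³`, `γ < 1/3`; the tree's named fact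
`Literature.Analysis.FluidPDE.DeRosa2019_thm21` of `FractionalNSPrescribedEnergy`, the single
remaining hypothesis of the barrier `HypodissipativeLerayNonuniqueness`) in §4.2 by running the
**main iterative proposition** Prop. 4.1 — one step of the Buckmaster–De Lellis–Székelyhidi–Vicol
scheme (mollification, gluing of exact smooth solutions of the fractional system, Mikado
perturbation; §§5–7) for the fractional Navier–Stokes–Reynolds system (NSR) — from the zero
triple, and a short **time-regularity** argument. This file fixes, for `𝕋³ = UnitAddTorus (Fin 3)`,
the vocabulary in which the tree transcribes the iteration, and vendors the second ingredient:

* `DeRosa.IsAdmissibleProfile` — the admissible energy profiles of the iteration from zero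
  (§4.1 (4.2) and §4.2 (4.11)); `DeRosa.IsDeRosaSequence` — the output of "apply Proposition 4.1
  iteratively with `(v₀, R₀, p₀) = (0,0,0)`" (§4.2): smooth solutions `(v_q, p_q, R̊_q)_q` of
  (NSR) from `v₀ = 0` with the inductive estimates (4.7)–(4.10) at every stage and the increment
  bounds (4.12).
* `DeRosa.timeRegularity` — **the time-regularity step of the proof of Thm. 2.1** (§4.2, last
  paragraph: "To recover the time regularity we fix a smooth standard mollifier … `v ∈ C^{β''}
  ([0,1] × 𝕋³)` … with `β'' < β' < β < 1/3` arbitrary"): the uniform limit of the velocities of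
  such a sequence with `R̊_q → 0`, bounded in `C⁰_t C^{β'}_x`, is `C^{β''}` in space–time; named
  fact, discharged in `DeRosaTimeRegularityProofs.lean` (`DeRosa.timeRegularity_holds`).

Prop. 4.1 itself — one step along a construction history (`DeRosa.inductiveStepLT`) and run from
zero (`DeRosa.iterativeSchemeLT`) — is vendored in `DeRosaStep.lean`, in the regime `γ < β` of the
exponents: Prop. 4.1 is printed for `0 < β < 1/3`, `0 < γ < 1/3` independent, but its printed
proof covers only `γ < β` (proof of (5.12), p. 13 of the arXiv text: "using (4.11),
`τ_q ℓ^{-2γ-2α} ≤ λ_{q+1}^{2γ}/(δ_q^{1/2} λ_q) ≤ 1`" needs `2γb ≤ 1 - β`, which (4.11) gives only for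
`γ ≤ β`; proofs of (5.18), p. 14, and of Lemma 5.9, p. 15: the bound "`‖v_q‖_{γ'} ≤ 1` for every
`γ' < β`" — a bound along the iteration from zero, §4.2 — is used at an exponent `γ' > γ`), which
is also the regime of every application in the paper (Thm. 1.2 "`γ < β < 1/3`", §4.2, §4.3); the
unrestricted transcription `DeRosa.iterativeScheme` formerly in this file had no proof in the
source for `γ ≥ β` and was withdrawn (D-0026 review), all consumers using `DeRosa.iterativeSchemeLT`.
The assembly "`DeRosa.iterativeSchemeLT` + `DeRosa.timeRegularity` ⇒ `DeRosa2019_thm21`" (the rest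
of §4.2: normalisation (4.11)–(4.13) with viscosity `μ = δ₁^{1/2}`, uniform convergence,
interpolation, the energy identity, undoing the scaling, the bound `‖v‖_β ≤ C_β K^{4/9}` and the
common initial datum) is `DeRosaSchemeProofs.lean`.

## Transcription conventions (those of `OnsagerBDSV`, which transcribes BDSV's Prop. 2.1)

* Parameters `λ_q = 2π⌈a^{b^q}⌉ = BDSV.freq a b q`, `δ_q = λ_q^{-2β} = BDSV.amp β a b q` ((4.5)–(4.6),
  identical with BDSV §2.1); sup norms `‖·‖₀`, `[·]₁` over `[0,T] × 𝕋³` with spatial derivatives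
  only (§3 of the paper) as the bound predicates `BDSV.SupLE`, `BDSV.DerivSupLE`; the inductive
  estimates (4.7)–(4.10) are LITERALLY BDSV's (2.3)–(2.6), `BDSV.InductiveEstimates M β α a b T e q v R`,
  and (4.12) is `BDSV.VelocityIncrementBound`; the profile hypothesis "a strictly positive
  function `e : [0,T] → ℝ⁺` satisfying (4.2) `sup_t |e'(t)| ≤ 1`" is `BDSV.IsNormalisedProfile T e`
  (smooth on `[0,T]`, as everywhere in the paper: "smooth functions `e`", §2).
* Triples are `Torus.IsFracNSReynoldsOn (Icc 0 T) γ ν v p R` (`FractionalNSReynolds`: jointly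
  smooth on `[0,T] × 𝕋³`, `∂ₜv + (v·∇)v + ∇p + ν(-Δ)^γ v = div R` classically, `div v = 0`, `R`
  symmetric). De Rosa's normalisations (4.3) `tr R̊ = 0` and (4.4) `∫ p = 0` are not demanded of
  the produced triples (dropping conclusions weakens the facts; §4.2 does not use them beyond the
  recovery of the pressure, which the tree's pressure-free weak formulation does not need).
* The viscosity. Prop. 4.1 is stated for (NSR) with a viscosity `ν` about which the paper says
  (§4.1): "In (NSR) the viscosity `ν` is just some small constant (in particular `ν < 1`)
  depending on some parameters of the inductive construction"; it is applied in §4.2 with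
  `ν = μ = δ₁^{1/2}` (a function of `a, b, β`) and in §4.3 with `ν_n = δ_n^{1+β'}`, the constants
  of §§5–7 being uniform in `0 < ν < 1` (Prop. 5.3: "`0 < ν < 1`"; Prop. 3.5 and the maximum
  principle hold for every `ν > 0` with `ν`-independent constants). Accordingly the facts of
  `DeRosaStep.lean` quantify `ν ∈ (0,1)` after the parameter `a` (and so `T > 0`, as in
  `BDSV.mainIteration`).

## References

* L. De Rosa, Comm. PDE 44 (2019), 335–365 = arXiv:1801.10235: §2 (Thm. 2.1), §3 (Hölder norms),
  §4.1 ((NSR), (4.2)–(4.12), Prop. 4.1), §4.2 (proof of Thm. 2.1: iteration from zero, time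
  regularity), §5.2 (proofs of Props. 5.3, 5.5), §5.3 (Lemma 5.9), §4.3. [`Derosa2018`]
* T. Buckmaster, C. De Lellis, L. Székelyhidi Jr., V. Vicol, CPAM 72 (2019) = arXiv:1701.08678,
  §2.1 (Prop. 2.1), §2.2. [`BuckmasterEtAl2018`]
* M. Colombo, L. De Rosa, SIAM J. Math. Anal. 52 (2020), 221–238, Thm. 1.1 (time regularity of
  `L^∞_t C^θ_x` weak solutions of Euler and hypodissipative Navier–Stokes). [`ColomboRosa2020`]
-/

open MeasureTheory Set Filter Topology
open scoped NNReal ENNReal ContDiff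

noncomputable section

namespace Literature.Analysis.FluidPDE

namespace DeRosa

/-- The flat three-torus `𝕋³ = (ℝ/ℤ)³`, local notation. -/
local notation "𝕋³" => UnitAddTorus (Fin 3)

/-- Euclidean `ℝ³`, local notation. -/
local notation "ℝ³" => EuclideanSpace ℝ (Fin 3)

/-! ## The admissible inputs of the iteration -/

/-- **Admissible normalised profiles for the iteration from zero** (De Rosa 2019, §4.1 (4.2) and
§4.2 (4.11)): a strictly positive smooth energy profile `e` on `[0,T]` with `sup |e'| ≤ 1`
(`BDSV.IsNormalisedProfile T e`) for which the zero triple satisfies the stage-`0` inductive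
estimates (4.7)–(4.10), i.e. (4.11) `δ₁ λ₀^{-α} ≤ e(t) ≤ δ₁` on `[0,T]` ("the pair `(v₀, R₀)`
trivially satisfies (4.7)–(4.9), whereas the estimate (4.10) … follows as a consequence of
(4.11)", §4.2). [cite: Derosa2018, §4.1 (4.2) and §4.2 (4.11)] -/
def IsAdmissibleProfile (M β α a b T : ℝ) (e : ℝ → ℝ) : Prop :=
  BDSV.IsNormalisedProfile T e ∧
    BDSV.InductiveEstimates M β α a b T e 0 (fun _ _ => (0 : ℝ³)) (fun _ _ _ => (0 : ℝ³))

/-- An admissible profile is a normalised profile. [folklore] -/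
theorem IsAdmissibleProfile.isNormalisedProfile {M β α a b T : ℝ} {e : ℝ → ℝ}
    (h : IsAdmissibleProfile M β α a b T e) : BDSV.IsNormalisedProfile T e :=
  h.1

/-- An admissible profile makes the zero triple satisfy the stage-`0` inductive estimates. [folklore] -/
theorem IsAdmissibleProfile.inductiveEstimates_zero {M β α a b T : ℝ} {e : ℝ → ℝ}
    (h : IsAdmissibleProfile M β α a b T e) :
    BDSV.InductiveEstimates M β α a b T e 0 (fun _ _ => (0 : ℝ³)) (fun _ _ _ => (0 : ℝ³)) :=
  h.2

/-! ## The outputs: De Rosa sequences -/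

/-- **A De Rosa sequence** for the parameters `(M, β, γ, α, a, b)`, viscosity `ν`, time `T` and
profile `e`: velocities, pressures and stresses `(v_q, p_q, R_q)_{q ∈ ℕ}` on `[0,T] × 𝕋³` such
that `v₀ = 0`, every `(v_q, p_q, R_q)` is a smooth solution of the fractional
Navier–Stokes–Reynolds system (NSR) with exponent `γ` and viscosity `ν`
(`Torus.IsFracNSReynoldsOn (Icc 0 T) γ ν`), the inductive estimates (4.7)–(4.10) hold at every
stage (`BDSV.InductiveEstimates`), and the increments obey (4.12)
`‖v_{q+1} - v_q‖₀ + λ_{q+1}^{-1}‖v_{q+1} - v_q‖₁ ≤ M δ_{q+1}^{1/2}` (`BDSV.VelocityIncrementBound`) —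
the output of "apply Proposition 4.1 iteratively with `(v₀, R₀, p₀) = (0,0,0)`" (§4.2).
[cite: Derosa2018, §4.1 Prop. 4.1, (4.7)–(4.10), (4.12); §4.2] -/
structure IsDeRosaSequence (M β γ α a b ν T : ℝ) (e : ℝ → ℝ) (v : ℕ → ℝ → 𝕋³ → ℝ³)
    (p : ℕ → ℝ → 𝕋³ → ℝ) (R : ℕ → ℝ → 𝕋³ → Fin 3 → ℝ³) : Prop where
  /-- The iteration starts from the zero velocity. -/
  velocity_zero : v 0 = fun _ _ => 0
  /-- Every stage solves the fractional Navier–Stokes–Reynolds system classically on `[0,T] × 𝕋³`. -/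
  isFracNSReynoldsOn : ∀ q, Torus.IsFracNSReynoldsOn (Icc 0 T) γ ν (v q) (p q) (R q)
  /-- The inductive estimates (4.7)–(4.10) hold at every stage. -/
  inductiveEstimates : ∀ q, BDSV.InductiveEstimates M β α a b T e q (v q) (R q)
  /-- The increment bound (4.12) holds at every stage. -/
  velocityIncrementBound : ∀ q,
    BDSV.VelocityIncrementBound M β a b T q (fun t x => v (q + 1) t x - v q t x)

/-! ## The time-regularity step (named fact) -/

/-- **De Rosa 2019, the time-regularity step of the proof of Thm. 2.1 — named fact** (§4.2, last
paragraph, pp. 9–10 of arXiv:1801.10235; after BDSV §2.2). In the proof of Thm. 2.1 the velocities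
`v_q` of the (rescaled, viscosity `1`) triples solving the fractional Navier–Stokes–Reynolds system
converge uniformly on `[0,1] × 𝕋³` to `v`, with `R̊_q → 0` uniformly and `(v_q)` "uniformly
bounded in `C⁰_t C^{β'}_x` for all `β' < β`"; De Rosa then shows ("To recover the time regularity
we fix a smooth standard mollifier `ψ` in space … `ṽ_q := v * ψ_{2^{-q}}` … using Schauder's
estimates … `‖(-Δ)^γ ṽ_q‖₀ ≤ ‖ṽ_q‖₁` … the series converges in `C⁰_x C^{β''}_t` … we obtain that
`v ∈ C^{β''}([0,1] × 𝕋³)` as desired, with `β'' < β' < β < 1/3` arbitrary") that the limit is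
Hölder in space–time. Transcription, parallel to `BDSV.timeRegularity`: for classical solutions
`(v_q, p_q, R_q)` of the fractional Navier–Stokes–Reynolds system with exponent `γ ∈ (0, 1/3)`
and viscosity `1` on `[0,T] × 𝕋³` (`Torus.IsFracNSReynoldsOn (Icc 0 T) γ 1`, `0 < T`), with
`v_q → u` uniformly on `[0,T] × 𝕋³`, `‖R_q‖₀ → 0`, and the slices `v_q(t)`, `t ∈ [0,T]`,
`β'`-Hölder on `𝕋³` with one constant for all `q, t`, where `0 < β' < 1/3`, the limit `u` is
`β''`-Hölder on `[0,T] × 𝕋³` (`HolderOnSpaceTime β'' T u`, product sup-metric) for every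
`β'' < β'`. (The same conclusion with `β'' = β'` is Colombo–De Rosa 2020, Thm. 1.1, for weak
solutions of the hypodissipative system in `L^∞_t C^θ_x`.) Discharged in
`DeRosaTimeRegularityProofs.lean` (`DeRosa.timeRegularity_holds`).
[cite: Derosa2018, §4.2 (proof of Thm. 2.1, time regularity)] -/
def timeRegularity : Prop :=
  ∀ (T : ℝ), 0 < T → ∀ (γ : ℝ), 0 < γ → γ < 1 / 3 → ∀ (β' : ℝ≥0), 0 < β' → β' < 1 / 3 →
    ∀ (v : ℕ → ℝ → 𝕋³ → ℝ³) (p : ℕ → ℝ → 𝕋³ → ℝ) (R : ℕ → ℝ → 𝕋³ → Fin 3 → ℝ³)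
      (u : ℝ → 𝕋³ → ℝ³),
      (∀ q, Torus.IsFracNSReynoldsOn (Icc 0 T) γ 1 (v q) (p q) (R q)) →
      (∀ ε > 0, ∃ N : ℕ, ∀ q ≥ N, ∀ t ∈ Icc 0 T, ∀ x, ‖v q t x - u t x‖ ≤ ε) →
      (∀ ε > 0, ∃ N : ℕ, ∀ q ≥ N, ∀ t ∈ Icc 0 T, ∀ x, ‖R q t x‖ ≤ ε) →
      (∃ C : ℝ≥0, ∀ q, ∀ t ∈ Icc 0 T, HolderWith C β' (v q t)) →
        ∀ β'' : ℝ≥0, β'' < β' → FunctionSpaces.HolderOnSpaceTime β'' T u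

/-! ## Sanity: the admissible profiles are a non-empty class (non-vacuity of the hypotheses) -/

/-- The hypothesis class of the iteration from zero (`DeRosa.IsAdmissibleProfile`, the input of
`DeRosa.iterativeSchemeLT` in `DeRosaStep.lean`) is inhabited whenever `δ₁ λ₀^{-α} ≤ c ≤ δ₁`: the
constant profile `e ≡ c` (`0 < c`) is admissible for `T > 0`, `1 ≤ a`, `0 ≤ M`, `0 ≤ β`
(from `BDSV` bounds on the parameters: `δ₀ ≤ 1`). [folklore] -/
theorem isAdmissibleProfile_const {M β α a b T c : ℝ} (hM : 0 ≤ M) (hβ : 0 ≤ β) (ha : 1 ≤ a)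
    (hc : 0 < c) (hlow : BDSV.amp β a b 1 * BDSV.freq a b 0 ^ (-α) ≤ c)
    (hupp : c ≤ BDSV.amp β a b 1) :
    IsAdmissibleProfile M β α a b T (fun _ => c) := by
  refine ⟨⟨contDiffOn_const, fun _ _ => hc, fun t _ => by simp⟩, ?_⟩
  exact
    { stress_le := fun t ht x => by
        change ‖(0 : Fin 3 → ℝ³)‖ ≤ _
        rw [norm_zero]
        exact mul_nonneg (BDSV.amp_pos ha 1).le (Real.rpow_nonneg (BDSV.freq_pos ha 0).le _)
      velocity_C1_le := ⟨0, 0, BDSV.supLE_zero T, BDSV.derivSupLE_zero T, by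
        rw [add_zero]
        exact mul_nonneg (mul_nonneg hM (Real.sqrt_nonneg _)) (BDSV.freq_pos ha 0).le⟩
      velocity_le := fun t ht x => by
        change ‖(0 : ℝ³)‖ ≤ _
        rw [norm_zero, sub_nonneg]
        exact Real.sqrt_le_one.2 (BDSV.amp_le_one ha hβ 0)
      energy_ge := fun t ht => by simpa using hlow
      energy_le := fun t ht => by simpa using hupp }

end DeRosa

end Literature.Analysis.FluidPDE
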